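import Mathlib
import Summits.HodgeConjecture.FermatCycles.HodgeFermatPropL5A

/-!
# PROPOSITION L5 (`tables/KR-FREE.md` §4) — part 2: the unit lifts and `propL5` (`HodgeFermat/PropL5.lean`; HF-G21a)

Tree copy (part 2 of 2) of the module `HodgeFermat/PropL5.lean` of the sibling cell's standalone package
`run/shared/lean/pub/pub-hodgefermat/lean/HodgeFermat/` (613 lines, sha256 `31e91f78ccd85872…`), source lines 325–613 (§§4–6: the unit lifts at 5, PROPOSITION L5 `propL5` and its final forms).
Filed by cell `pub-hfermat`, seat prover-1 gen-3, on the COORDINATOR KEEPER RULING of 2026-08-25 (gem sweep H1: take the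
off-gate kernel theorem `thmFstar` through the gate) — here THEOREM F* of `tables/DPRIME-THEOREM.md` §9 IN FULL, i.e.
PROPOSITION D′(3N) and the descent (`HodgeFermat/PropDPrimeNFinal.lean`, GATE HF-G34), the last off-gate form of THEOREM F*
(its first two forms, `DecodingFinal.thmFstar` = F* at the prime levels and `ThmFstarNFinal.thmFstar` = F*(3N), landed on
2026-08-25 as `HodgeFermatThmFstar.lean` / `HodgeFermatThmFstarN.lean`, seats prover-1 gen-0 / gen-2); this file is one link of
the import closure of `PropDPrimeNFinal.propDprime` (the sibling's KR-free chain: THEOREM L, COROLLARY M, THEOREM D6,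
THEOREM U⁺, THEOREM KR6, THEOREM Z3U) on top of those landed chains.  The source module is the sibling's hub-checked module of
record (pub-hodgefermat `CERT.md` l.867, GATE HF-G21a); its declarations are copied VERBATIM.
Deviations from the source module, exhaustively: the `import` lines (tree modules `Summits.HodgeConjecture.FermatCycles.
HodgeFermat*` instead of `HodgeFermat.*`); this module docstring; the `set_option`/namespace preamble (source l.37–39) and part 1's `open … renaming …` line are repeated at the top because the module is split; one-line docstrings added (gate lint) to `coprime_five_n`. The module docstring is quoted in full in part 1.
Every other line — in particular every declaration's statement and proof — is byte-identical to the source.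
HONEST FRAMING: explicit algebraic cycles for specific Hodge classes on Fermat/Delsarte varieties; residual open instances
listed; no claim on general Hodge.  (This file is arithmetic of CM types / finite combinatorics / analytic number theory
of the sibling's KR-free programme; it claims nothing about cycles.)
-/

set_option autoImplicit false

namespace HodgeFermat.KRFree.PropL5

open HodgeFermat.KRFree.Decoding renaming unit_mul_not_dvd → not_dvd_mul_of_coprime

/-! ## The Z1 side over `1̄`: a triple `(5, s, t)` with `c(1̄) = 1` has the full fibre over `1̄` -/

/-- `T = (5, s, t)` of level `N = 5n` with `⟨s⟩_n + ⟨t⟩_n = n − 5` (carry of `T mod n` at `1̄` equal to 1):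
every residue `1 + jn` above `1̄` (any `j`) has residue sum `N` (carry 1). -/
lemma Z1_fibre_one (n s t j : ℕ) (hn : 5 < n) (hs : 5 * n ∣ 5 + s + t)
    (hc : s % n + t % n = n - 5) :
    rsum (5 * n) (5, s, t) (1 + j * n) = 5 * n := by
  obtain ⟨Bs, bs, es⟩ := lift_repr n 1 s j (by omega)
  obtain ⟨Bt, bt, et⟩ := lift_repr n 1 t j (by omega)
  rw [Nat.one_mul] at es et
  have e5 : (1 + j * n) * 5 % (5 * n) = 5 := mod_eq_of_repr (q := j) (by ring) (by omega)
  have hd := rsum_dvd (N := 5 * n) (1 + j * n) hs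
  unfold rsum at hd ⊢
  simp only at hd ⊢
  rw [e5, es, et] at hd ⊢
  obtain ⟨k, hk⟩ := hd
  have hc' : s % n + t % n + 5 = n := by omega
  have h1 : n * (1 + Bs + Bt) = n * (5 * k) := by linarith
  have h2 := Nat.eq_of_mul_eq_mul_left (by omega : 0 < n) h1
  have hk1 : k = 1 := by omega
  subst hk1
  have hBt : Bt = 4 - Bs := by omega
  subst hBt
  interval_cases Bs <;> omega

/-! ## PROPOSITION L5's fibre over `5̄` (from `L5Fibre.lean`, generation 20, verbatim) -/

/-- `5 ∤ cj` for `c, j ∈ [1, 4]` -/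
lemma mod5_ne_zero {c j : ℕ} (hc1 : 1 ≤ c) (hc4 : c ≤ 4) (hj1 : 1 ≤ j) (hj4 : j ≤ 4) :
    c * j % 5 ≠ 0 := by
  intro h
  rcases (Nat.Prime.dvd_mul Nat.prime_five).mp (Nat.dvd_of_mod_eq_zero h) with h' | h' <;> omega

/-- the residue of `(N − c) h_j` modulo `N = 5n`: `⟨(N − c)(5 + jn)⟩_N = (5 − κ) n − 5c`, `κ = ⟨cj⟩_5 ≠ 0` -/
lemma term_mod (n c j : ℕ) (hn : 20 < n) (hc1 : 1 ≤ c) (hc4 : c ≤ 4) (hκ0 : c * j % 5 ≠ 0) :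
    (5 + j * n) * (5 * n - c) % (5 * n) = (5 - c * j % 5) * n - 5 * c := by
  obtain ⟨κ, hκ⟩ : ∃ κ, κ = c * j % 5 := ⟨_, rfl⟩
  obtain ⟨q', hq'⟩ : ∃ q', q' = c * j / 5 := ⟨_, rfl⟩
  have hκ5 : κ < 5 := by rw [hκ]; exact Nat.mod_lt _ (by norm_num)
  have hκ1 : 1 ≤ κ := by omega
  have hdm : 5 * q' + κ = c * j := by rw [hκ, hq']; exact Nat.div_add_mod (c * j) 5
  rw [← hκ]
  have hjn : j ≤ j * n := Nat.le_mul_of_pos_right j (by omega)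
  have hq : q' ≤ 4 + j * n := by
    have h1 : c * j / 5 ≤ c * j := Nat.div_le_self _ _
    have h2 : c * j ≤ 4 * j := Nat.mul_le_mul_right j hc4
    omega
  have hb : 5 * c ≤ (5 - κ) * n :=
    le_trans (by omega : 5 * c ≤ 1 * n) (Nat.mul_le_mul_right n (by omega))
  have hr : (5 - κ) * n - 5 * c < 5 * n := by
    have : (5 - κ) * n ≤ 4 * n := Nat.mul_le_mul_right n (by omega)
    omega
  refine mod_eq_of_repr (q := 4 + j * n - q') ?_ hr
  zify [(by omega : c ≤ 5 * n), hq, (by omega : κ ≤ 5), hb] at hdm ⊢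
  linear_combination (n : ℤ) * hdm

/-- the fibre identity over `5̄`: `⟨5 h_j⟩_N + ⟨(N − a) h_j⟩_N + ⟨(N − b) h_j⟩_N = N`, `h_j = 5 + jn`, `b = 5 − a` -/
theorem fibre_sum (n a j : ℕ) (hn : 20 < n) (ha1 : 1 ≤ a) (ha4 : a ≤ 4) (hj1 : 1 ≤ j) (hj4 : j ≤ 4) :
    (5 + j * n) * 5 % (5 * n) + (5 + j * n) * (5 * n - a) % (5 * n)
      + (5 + j * n) * (5 * n - (5 - a)) % (5 * n) = 5 * n := by
  have hκa := mod5_ne_zero ha1 ha4 hj1 hj4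
  have hκb := mod5_ne_zero (c := 5 - a) (by omega) (by omega) hj1 hj4
  have t1 : (5 + j * n) * 5 % (5 * n) = 25 := mod_eq_of_repr (q := j) (by ring) (by omega)
  rw [t1, term_mod n a j hn ha1 ha4 hκa, term_mod n (5 - a) j hn (by omega) (by omega) hκb]
  have hsum : a * j + (5 - a) * j = 5 * j := by zify [(by omega : a ≤ 5)]; ring
  have hn5 : (5 - a * j % 5) * n + (5 - (5 - a) * j % 5) * n = 5 * n := by
    rw [← Nat.add_mul]; congr 1; omega
  have hb1 : 5 * a ≤ (5 - a * j % 5) * n :=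
    le_trans (by omega : 5 * a ≤ 1 * n) (Nat.mul_le_mul_right n (by omega))
  have hb2 : 5 * (5 - a) ≤ (5 - (5 - a) * j % 5) * n :=
    le_trans (by omega : 5 * (5 - a) ≤ 1 * n) (Nat.mul_le_mul_right n (by omega))
  omega

/-- the same as membership: `h_j ∈ H_T` for `T = (5, N − a, ·)` in the model (`InH` reads two entries) -/
theorem fibre_inH (n a c j : ℕ) (hn : 20 < n) (ha1 : 1 ≤ a) (ha4 : a ≤ 4) (hj1 : 1 ≤ j) (hj4 : j ≤ 4) :
    InH (5 * n) (5, 5 * n - a, c) (5 + j * n) := by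
  have h := fibre_sum n a j hn ha1 ha4 hj1 hj4
  have hκb := mod5_ne_zero (c := 5 - a) (by omega) (by omega) hj1 hj4
  have hpos : 0 < (5 + j * n) * (5 * n - (5 - a)) % (5 * n) := by
    rw [term_mod n (5 - a) j hn (by omega) (by omega) hκb]
    have : 5 * (5 - a) < (5 - (5 - a) * j % 5) * n :=
      lt_of_lt_of_le (by omega : 5 * (5 - a) < 1 * n) (Nat.mul_le_mul_right n (by omega))
    omega
  unfold InH
  simp only
  omega

/-- the lifts `h_j = 5 + jn` (`j ∈ [1,4]`) of `5̄` are units of `ℤ/N` when `5 ∤ n` -/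
theorem hj_unit (n j : ℕ) (h5 : ¬ 5 ∣ n) (hj1 : 1 ≤ j) (hj4 : j ≤ 4) :
    Nat.Coprime (5 + j * n) (5 * n) := by
  have hc5n : Nat.Coprime 5 n := (Nat.Prime.coprime_iff_not_dvd Nat.prime_five).mpr h5
  have hc5j : Nat.Coprime 5 j := (Nat.Prime.coprime_iff_not_dvd Nat.prime_five).mpr (by omega)
  refine Nat.Coprime.mul_right ?_ ?_
  · exact Nat.coprime_self_add_left.mpr (Nat.coprime_mul_iff_left.mpr ⟨hc5j.symm, hc5n.symm⟩)
  · exact (Nat.coprime_add_mul_right_left 5 n j).mpr hc5n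

/-! ## The two normalisations (units from the Chinese remainder theorem) -/

/-- `n` with `5 ∤ n` is prime to `5` -/
lemma coprime_five_n {n : ℕ} (h5n : ¬ 5 ∣ n) : Nat.Coprime n 5 :=
  Nat.coprime_comm.mp ((Nat.Prime.coprime_iff_not_dvd Nat.prime_five).mpr h5n)

/-- first normalisation: a unit `u₀` of `ℤ/N` with `u₀ x₁ ≡ 5 (mod N)`, for `x₁` divisible by 5 and prime to `n` -/
lemma norm1 (n x₁ : ℕ) (hn : 1 < n) (h5n : ¬ 5 ∣ n) (hx₁ : 5 ∣ x₁) (hx₁n : Nat.Coprime x₁ n) :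
    ∃ u₀, Nat.Coprime u₀ (5 * n) ∧ u₀ * x₁ ≡ 5 [MOD 5 * n] := by
  have hco := coprime_five_n h5n
  obtain ⟨v, -, hv⟩ := Nat.exists_mul_mod_eq_of_coprime 5 hx₁n (by omega)
  obtain ⟨u₀, hu₀n, hu₀5⟩ := Nat.chineseRemainder hco v 1
  have h1 : u₀ * x₁ ≡ 5 [MOD n] := by
    have ha : u₀ * x₁ ≡ v * x₁ [MOD n] := hu₀n.mul_right x₁
    have hb : v * x₁ ≡ 5 [MOD n] := by unfold Nat.ModEq; rw [mul_comm]; exact hv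
    exact ha.trans hb
  have h2 : u₀ * x₁ ≡ 5 [MOD 5] := by
    unfold Nat.ModEq
    rw [Nat.mod_self]
    exact Nat.mod_eq_zero_of_dvd (Dvd.dvd.mul_left hx₁ u₀)
  refine ⟨u₀, Nat.Coprime.mul_right ?_ ?_, ?_⟩
  · unfold Nat.Coprime; rw [hu₀5.gcd_eq]; exact Nat.gcd_one_left 5
  · have : Nat.Coprime (u₀ * x₁) n := by
      unfold Nat.Coprime; rw [h1.gcd_eq]; exact hco.symm
    exact Nat.Coprime.coprime_mul_right this
  · have := (Nat.modEq_and_modEq_iff_modEq_mul hco).mp ⟨h1, h2⟩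
    rwa [mul_comm] at this

/-- second normalisation: a unit `u₁` of `ℤ/N` fixing `5` with `u₁ s ≡ N − a (mod N)`, when `⟨s⟩_n = n − a`, `5 ∤ s` -/
lemma norm2 (n s a : ℕ) (hn : 5 < n) (h5n : ¬ 5 ∣ n) (h5s : ¬ 5 ∣ s) (ha1 : 1 ≤ a) (ha4 : a ≤ 4)
    (hs : s % n = n - a) :
    ∃ u₁, Nat.Coprime u₁ (5 * n) ∧ u₁ * 5 ≡ 5 [MOD 5 * n] ∧ u₁ * s ≡ 5 * n - a [MOD 5 * n] := by
  have hco := coprime_five_n h5n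
  have hs5 : Nat.Coprime s 5 := ((Nat.Prime.coprime_iff_not_dvd Nat.prime_five).mpr h5s).symm
  obtain ⟨w, -, hw⟩ := Nat.exists_mul_mod_eq_of_coprime (5 - a) hs5 (by norm_num)
  obtain ⟨u₁, hu₁n, hu₁5⟩ := Nat.chineseRemainder hco 1 w
  have hw5 : ¬ 5 ∣ w := by
    intro h
    have : s * w % 5 = 0 := Nat.mod_eq_zero_of_dvd (Dvd.dvd.mul_left h s)
    rw [this, Nat.mod_eq_of_lt (by omega : 5 - a < 5)] at hw
    omega
  refine ⟨u₁, Nat.Coprime.mul_right ?_ ?_, ?_, ?_⟩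
  · unfold Nat.Coprime; rw [hu₁5.gcd_eq]
    exact ((Nat.Prime.coprime_iff_not_dvd Nat.prime_five).mpr hw5).symm
  · unfold Nat.Coprime; rw [hu₁n.gcd_eq]; exact Nat.gcd_one_left n
  · have h1 : u₁ * 5 ≡ 5 [MOD n] := by
      have := hu₁n.mul_right 5
      rwa [Nat.one_mul] at this
    have h2 : u₁ * 5 ≡ 5 [MOD 5] := by
      unfold Nat.ModEq; rw [Nat.mul_mod_left, Nat.mod_self]
    have := (Nat.modEq_and_modEq_iff_modEq_mul hco).mp ⟨h1, h2⟩
    rwa [mul_comm] at this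
  · have h1 : u₁ * s ≡ 5 * n - a [MOD n] := by
      have ha : u₁ * s ≡ s [MOD n] := by
        have := hu₁n.mul_right s
        rwa [Nat.one_mul] at this
      have hb : s ≡ 5 * n - a [MOD n] := by
        unfold Nat.ModEq
        rw [hs, mod_eq_of_repr (x := 5 * n - a) (q := 4) (r := n - a) (by omega) (by omega)]
      exact ha.trans hb
    have h2 : u₁ * s ≡ 5 * n - a [MOD 5] := by
      have ha : u₁ * s ≡ w * s [MOD 5] := hu₁5.mul_right s
      have hb : w * s ≡ 5 * n - a [MOD 5] := by
        unfold Nat.ModEq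
        rw [mul_comm, hw, Nat.mod_eq_of_lt (by omega : 5 - a < 5),
          mod_eq_of_repr (x := 5 * n - a) (q := n - 1) (r := 5 - a) (by omega) (by omega)]
      exact ha.trans hb
    have := (Nat.modEq_and_modEq_iff_modEq_mul hco).mp ⟨h1, h2⟩
    rwa [mul_comm] at this


/-! ## PROPOSITION L5 -/

/-- a unit of `ℤ/(5n)` is prime to 5 -/
lemma not_five_dvd_of_coprime {u n : ℕ} (hu : Nat.Coprime u (5 * n)) : ¬ 5 ∣ u := by
  intro h
  have h1 : 5 ∣ Nat.gcd u (5 * n) := Nat.dvd_gcd h ⟨n, rfl⟩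
  rw [hu] at h1
  omega

/-- the carry of `(5, s, t) mod n` at `1̄` is 1 or 2: `⟨s⟩_n + ⟨t⟩_n ∈ {n − 5, 2n − 5}` -/
lemma carry_one_cases {n s t : ℕ} (hn : 5 < n) (hs : 5 * n ∣ 5 + s + t) :
    s % n + t % n = n - 5 ∨ s % n + t % n = 2 * n - 5 := by
  have hsn : n ∣ 5 + s + t := Nat.dvd_trans ⟨5, by ring⟩ hs
  have hm : 5 + s % n + t % n ≡ 5 + s + t [MOD n] :=
    ((Nat.ModEq.refl 5).add (Nat.mod_modEq s n)).add (Nat.mod_modEq t n)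
  obtain ⟨k, hk⟩ := Nat.modEq_zero_iff_dvd.mp (hm.trans (Nat.modEq_zero_iff_dvd.mpr hsn))
  have h1 : s % n < n := Nat.mod_lt _ (by omega)
  have h2 : t % n < n := Nat.mod_lt _ (by omega)
  have hk1 : 1 ≤ k := by
    by_contra h
    have : k = 0 := by omega
    subst this; omega
  have hk2 : k ≤ 2 := by
    by_contra h
    have : n * 3 ≤ n * k := Nat.mul_le_mul_left n (by omega)
    omega
  interval_cases k <;> omega

/-- **PROPOSITION L5** (`tables/KR-FREE.md` §4; Koblitz–Rohrlich 1978, p. 1197, Case 3 with `p = 5 ∥ N`,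
"omitted in the interest of brevity").  Level `N = 5n` with `5 ∤ n` and `n > 20`.  Let `T = (x₁, x₂, x₃)` and
`T' = (y₁, y₂, y₃)` be triples of level `N` (`N ∣` the entry sums) such that `T` has pattern Z1 at 5 with unit
cofactor — `5 ∣ x₁`, `gcd(x₁, n) = 1`, `5 ∤ x₂ x₃` — and `T'` has pattern U at 5 — `5 ∤ y₁ y₂ y₃`.  Then `T` and `T'`
do NOT have the same CM type.  (No squarefreeness or parity hypothesis on `n` is needed.  For `n ≤ 20`,
i.e. `N ∈ {35, 55, 65, 85, 95}` among the levels prime to 6, the conclusion is part of the kernel-checked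
facts F35…F95 of `KRFreeFacts.lean`.) -/
theorem propL5 (n x₁ x₂ x₃ y₁ y₂ y₃ : ℕ) (hn : 20 < n) (h5n : ¬ 5 ∣ n)
    (hX : 5 * n ∣ x₁ + x₂ + x₃) (hx₁ : 5 ∣ x₁) (hx₁n : Nat.Coprime x₁ n) (hx₂ : ¬ 5 ∣ x₂) (hx₃ : ¬ 5 ∣ x₃)
    (hY : 5 * n ∣ y₁ + y₂ + y₃) (hy₁ : ¬ 5 ∣ y₁) (hy₂ : ¬ 5 ∣ y₂) (hy₃ : ¬ 5 ∣ y₃)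
    (hH : SameType (5 * n) (x₁, x₂, x₃) (y₁, y₂, y₃)) : False := by
  have hn0 : 0 < n := by omega
  have hN : 0 < 5 * n := by omega
  have hco5n : Nat.Coprime 5 n := (Nat.Prime.coprime_iff_not_dvd Nat.prime_five).mpr h5n
  have five_dvd_mul : ∀ {u v : ℕ}, ¬ 5 ∣ u → ¬ 5 ∣ v → ¬ 5 ∣ u * v :=
    fun hu hv h => ((Nat.Prime.dvd_mul Nat.prime_five).mp h).elim hu hv
  have hN5 : ¬ 5 * n ∣ 5 := fun h => by have := Nat.le_of_dvd (by norm_num) h; omega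
  -- STEP 1 (first normalisation): scale by a unit `u₀` with `u₀ x₁ ≡ 5 (mod N)`
  obtain ⟨u₀, hu₀, hu₀x⟩ := norm1 n x₁ (by omega) h5n hx₁ hx₁n
  have h5u₀ := not_five_dvd_of_coprime hu₀
  have hS : SameType (5 * n) (5, u₀ * x₂, u₀ * x₃) (u₀ * y₁, u₀ * y₂, u₀ * y₃) :=
    sameType_congr_left hu₀x (Nat.ModEq.refl _) (sameType_scale hu₀ hH)
  have hsum : 5 * n ∣ 5 + u₀ * x₂ + u₀ * x₃ := by
    have h : 5 * n ∣ u₀ * x₁ + (u₀ * x₂ + u₀ * x₃) := by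
      rw [← mul_add, ← mul_add, ← add_assoc]; exact Dvd.dvd.mul_left hX u₀
    have e : 5 + (u₀ * x₂ + u₀ * x₃) ≡ u₀ * x₁ + (u₀ * x₂ + u₀ * x₃) [MOD 5 * n] :=
      hu₀x.symm.add_right _
    rw [add_assoc]
    exact Nat.modEq_zero_iff_dvd.mp (e.trans (Nat.modEq_zero_iff_dvd.mpr h))
  have h5s : ¬ 5 ∣ u₀ * x₂ := five_dvd_mul h5u₀ hx₂
  have h5t : ¬ 5 ∣ u₀ * x₃ := five_dvd_mul h5u₀ hx₃
  have hY' : 5 * n ∣ u₀ * y₁ + u₀ * y₂ + u₀ * y₃ := by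
    rw [← mul_add, ← mul_add]; exact Dvd.dvd.mul_left hY u₀
  have h5y₁' : ¬ 5 ∣ u₀ * y₁ := five_dvd_mul h5u₀ hy₁
  have h5y₂' : ¬ 5 ∣ u₀ * y₂ := five_dvd_mul h5u₀ hy₂
  have h5y₃' : ¬ 5 ∣ u₀ * y₃ := five_dvd_mul h5u₀ hy₃
  -- STEP 2 ((E) at `1̄`): the carry of `T mod n` at `1̄` must be 2
  rcases carry_one_cases (by omega) hsum with hA | hB
  · -- carry 1: the whole fibre over `1̄` lies in `H_T`, hence in `H_{T'}` — against LEMMA N (U)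
    obtain ⟨j, hj, h5j, hnot⟩ :=
      U_bound n 1 (u₀ * y₁) (u₀ * y₂) (u₀ * y₃) hn0 h5n (Nat.coprime_one_left n) hY' h5y₁' h5y₂' h5y₃'
    apply hnot
    have hco := lift_coprime (Nat.coprime_one_left n) h5j
    rw [← hS (1 + j * n) hco]
    refine (inH_iff_rsum hN hsum (not_dvd_mul_of_coprime hco hN5)
      (not_dvd_mul_of_coprime hco (fun h => h5s (Nat.dvd_trans ⟨n, rfl⟩ h)))
      (not_dvd_mul_of_coprime hco (fun h => h5t (Nat.dvd_trans ⟨n, rfl⟩ h)))).mpr ?_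
    exact Z1_fibre_one n (u₀ * x₂) (u₀ * x₃) j (by omega) hsum hA
  · -- carry 2: `⟨s⟩_n = n − a`, `⟨t⟩_n = n − b`, `a + b = 5`
    have hmods : (u₀ * x₂) % n < n := Nat.mod_lt _ hn0
    have hmodt : (u₀ * x₃) % n < n := Nat.mod_lt _ hn0
    have ha1 : 1 ≤ n - (u₀ * x₂) % n := by omega
    have ha4 : n - (u₀ * x₂) % n ≤ 4 := by omega
    -- STEP 3 (second normalisation): scale by `u₁` fixing 5 with `u₁ s ≡ N − a`
    obtain ⟨u₁, hu₁, hu₁5, hu₁s⟩ :=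
      norm2 n (u₀ * x₂) (n - (u₀ * x₂) % n) (by omega) h5n h5s ha1 ha4 (by omega)
    have h5u₁ := not_five_dvd_of_coprime hu₁
    have hS2 : SameType (5 * n) (5, 5 * n - (n - (u₀ * x₂) % n), u₁ * (u₀ * x₃))
        (u₁ * (u₀ * y₁), u₁ * (u₀ * y₂), u₁ * (u₀ * y₃)) :=
      sameType_congr_left hu₁5 hu₁s (sameType_scale hu₁ hS)
    have hY'' : 5 * n ∣ u₁ * (u₀ * y₁) + u₁ * (u₀ * y₂) + u₁ * (u₀ * y₃) := by
      rw [← mul_add, ← mul_add]; exact Dvd.dvd.mul_left hY' u₁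
    -- STEP 4 (the fibre over `5̄`): all four unit lifts `5 + jn` are in `H_T` — against LEMMA N (U) for `T'`
    obtain ⟨j, hj, h5j, hnot⟩ :=
      U_bound n 5 (u₁ * (u₀ * y₁)) (u₁ * (u₀ * y₂)) (u₁ * (u₀ * y₃)) hn0 h5n hco5n hY''
        (five_dvd_mul h5u₁ h5y₁') (five_dvd_mul h5u₁ h5y₂') (five_dvd_mul h5u₁ h5y₃')
    have hj1 : 1 ≤ j := by
      rcases Nat.eq_zero_or_pos j with rfl | h
      · exact absurd ⟨1, by ring⟩ h5j
      · exact h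
    apply hnot
    rw [← hS2 (5 + j * n) (hj_unit n j h5n hj1 hj)]
    exact fibre_inH n (n - (u₀ * x₂) % n) (u₁ * (u₀ * x₃)) j hn ha1 ha4 hj1 hj

/-! ## Kernel instances (not used): `N = 385 = 5·77` -/

/-- `Z1_fibre_one` at `n = 77`: `T = (5, 379, 1)` (`⟨379⟩₇₇ + ⟨1⟩₇₇ = 71 + 1 = 72 = n − 5`): every lift of `1̄`
has residue sum `N` -/
example : ∀ j ∈ [0, 1, 2, 3, 4], rsum 385 (5, 379, 1) (1 + j * 77) = 385 := by
  unfold rsum; decide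

/-- `U_bound` at `n = 77`, `t̄₀ = 1̄`, `T' = (1, 2, 382)`: of the four unit lifts `1, 78, 232, 309` of `1̄`
(`155 = 5·31` is the non-unit) exactly `309 = 1 + 4·77` lies outside `H_{T'}` (`⟨309⟩ + ⟨618⟩ = 309 + 233 ≥ 385`),
so `N_{T'}(1̄) = 3` -/
example : ¬ 5 ∣ 1 + 4 * 77 ∧ ¬ InH 385 (1, 2, 382) (1 + 4 * 77)
    ∧ InH 385 (1, 2, 382) 1 ∧ InH 385 (1, 2, 382) (1 + 1 * 77) ∧ InH 385 (1, 2, 382) (1 + 3 * 77) := by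
  unfold InH; decide

/-- the lift sum `Σ_j ⟨(t₀ + jn)x⟩_N = 5⟨t₀x⟩_n + 10n` at `n = 77`, `t₀ = 3`, `x = 2` -/
example : ((List.range 5).map fun j => (3 + j * 77) * 2 % 385).sum = 5 * (3 * 2 % 77) + 10 * 77 := by
  decide

#print axioms propL5

end HodgeFermat.KRFree.PropL5
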